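import Summits.ResolutionOfSingularities.ResolutionOfSingularities.Theses.AbhyankarShadows
import Summits.ResolutionOfSingularities.ResolutionOfSingularities.Theorems.RegularBlowupsDesingularization
import Summits.ResolutionOfSingularities.ResolutionOfSingularities.Theorems.ValuativePatchingRelFormatUpgrade
import Literature.AlgebraicGeometry.Resolution.BlowupsIntegral
import Literature.AlgebraicGeometry.Resolution.BlowupsProperProofs

/-!
# Negative-lane lemmas for crux `PatchingPerfect` (stmt-ResolutionOfSingularities-16089), line
# `birth`: the single-blow-up FORMAT of stub 2 is free modulo stub 1

Stub 2 of `Cruxes/PatchingPerfect/Lines/birth.lean` (`ExcAdmissibleAt k → SingAdmissibleAt k`)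
concludes with a Sing-admissible desingularization in BLOW-UP FORMAT: ONE blowing up `Bl_J V → V`
of `V = Bl_I U` (`U` regular) along a non-zero `J` cosupported, set-theoretically, in the singular
locus of `V`, with regular source. Is the format an extra burden compared with a classical strong
resolution (any proper birational `φ : Y → V`, `Y` regular, an isomorphism over `Reg V`)? At every
field `k`, NO, modulo stub 1 (Axiom 4 on regular `k`-varieties), which the line assumes anyway
(standing disprover, cdisprove g2, `Cruxes/PatchingPerfect/Disproof.lean` §4.5; statements inlined):

* `patchingPerfect_birth_strongRes_of_singAdmissible` — a Sing-admissible regular blowing up IS a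
  strong resolution (proper, birational, isomorphic over `Reg V ⊆ V ∖ V(J)`).
* `patchingPerfect_birth_singAdmissible_of_principalization_of_strongRes` — conversely, Axiom 4 at
  `k` and a format-free strong resolution of `Bl_I U` give a Sing-admissible regular blowing up
  (Raynaud–Gruson `Reg V`-admissible domination, Stacks 081T; Axiom 4 on the regular `Y`; Stacks
  080A read backwards; Temkin 2008 Lemma 2.1.4 — the tree's generic
  `exists_isBlowup_supported_isRegular_of_isIso_over`).
* `patchingPerfect_birthStubsAt_iff_principalization_and_strongRes` — hence (stub 1 ∧ stub 2) at
  `k` ⟺ Axiom 4 at `k` ∧ strong resolution of blowings up of regular `k`-varieties: the line's open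
  content is Piltant's Axiom 4 plus classical strong resolution of sandwiched singularities over the
  one perfect field, with no format tax (per-field form of the sibling's
  `sandwichedStrongBlowup_iff_strong_and_principalization`).
-/

noncomputable section

set_option linter.dupNamespace false

open CategoryTheory CategoryTheory.Limits AlgebraicGeometry TopologicalSpace
open Literature.AlgebraicGeometry.Resolution
open Summit.ResolutionOfSingularities.ResolutionOfSingularities.Theorems

namespace Summit.ResolutionOfSingularities.ResolutionOfSingularities.Theorems.PatchingPerfect.Negative

/-- **A Sing-admissible regular blowing up of `Bl_I U` is a strong resolution of it** (proper and
birational — tree `IsBlowup.isProper` / `isBirational'` — and an isomorphism over the regular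
locus, which is open and misses `V(J)`, tree `IsBlowup.isIso_morphismRestrict`).
[cite: GortzWedhorn2020, Prop. 13.91 (3)] -/
theorem patchingPerfect_birth_strongRes_of_singAdmissible (k : Type) [Field k]
    (h : ∀ (U V : Scheme.{0}) (f : U ⟶ Spec (.of k)) (η : V ⟶ U) (I : U.IdealSheafData),
      IsSeparated f → LocallyOfFiniteType f → QuasiCompact f → IsIntegral U → Scheme.IsRegular U →
      I ≠ ⊥ → IsBlowup η I →
        ∃ (J : V.IdealSheafData) (V' : Scheme.{0}) (π : V' ⟶ V),
          J ≠ ⊥ ∧ (∀ x : V, x ∈ J.support → ¬ IsRegularLocalRing (V.presheaf.stalk x)) ∧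
            IsBlowup π J ∧ Scheme.IsRegular V') :
    ∀ (U V : Scheme.{0}) (f : U ⟶ Spec (.of k)) (η : V ⟶ U) (I : U.IdealSheafData),
      IsSeparated f → LocallyOfFiniteType f → QuasiCompact f → IsIntegral U → Scheme.IsRegular U →
      I ≠ ⊥ → IsBlowup η I →
        ∃ (Y : Scheme.{0}) (φ : Y ⟶ V), IsResolution φ ∧
          ∃ W : V.Opens, (W : Set V) = Scheme.regularLocus V ∧ IsIso (φ ∣_ W) := by
  intro U V f η I hf₁ hf₂ hf₃ hU hUreg hI hη
  haveI := hf₁; haveI := hf₂; haveI := hf₃; haveI := hU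
  haveI : IsLocallyNoetherian U := LocallyOfFiniteType.isLocallyNoetherian f
  haveI : IsIntegral V := hη.isIntegral hI
  haveI : IsProper η := hη.isProper
  haveI : LocallyOfFiniteType (η ≫ f) := inferInstance
  haveI : IsLocallyNoetherian V := LocallyOfFiniteType.isLocallyNoetherian (η ≫ f)
  obtain ⟨J, V', π, hJ, hJsing, hπ, hreg⟩ := h U V f η I hf₁ hf₂ hf₃ hU hUreg hI hη
  haveI : IsProper π := hπ.isProper
  let W : V.Opens :=
    ⟨Scheme.regularLocus V, isOpen_regularLocus_of_locallyOfFiniteType_field (η ≫ f)⟩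
  have hdisj : Disjoint (W : Set V) (J.support : Set V) :=
    Set.disjoint_left.mpr fun x hxW hxJ => hJsing x hxJ hxW
  exact ⟨V', π, ⟨inferInstance, hπ.isBirational' hJ, hreg⟩, W, rfl, hπ.isIso_morphismRestrict hdisj⟩

/-- **FORMAT UPGRADE at one field**: Axiom 4 on regular `k`-varieties (stub 1 at `k`) and a
format-free strong resolution of every blowing up `V = Bl_I U` of a regular `k`-variety give a
Sing-admissible regular blowing up of `V` (stub 2's conclusion at `k`): `Reg V`-admissible
domination `Bl_{I₀} V → Y` of the strong resolution `φ : Y → V` (Stacks 081T + 080E, tree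
`exists_isBlowup_dominating`), Axiom 4 on the regular `Y` and Stacks 080A read backwards, then
Temkin's Lemma 2.1.4 to compose — packaged in the tree as
`exists_isBlowup_supported_isRegular_of_isIso_over`. [cite: StacksProject, Tag 081T]
[cite: Temkin2008, Lemma 2.1.4] [cite: Piltant2013, §2 Axiom 4] -/
theorem patchingPerfect_birth_singAdmissible_of_principalization_of_strongRes (k : Type) [Field k]
    (hA : ∀ (U : Scheme.{0}) (f : U ⟶ Spec (.of k)),
      IsSeparated f → LocallyOfFiniteType f → QuasiCompact f → IsIntegral U → Scheme.IsRegular U →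
      ∀ I : U.IdealSheafData, I ≠ ⊥ →
        ∃ (Q : U.IdealSheafData) (U' : Scheme.{0}) (σ : U' ⟶ U),
          (Q.support : Set U) ⊆ I.support ∧ IsBlowup σ Q ∧ Scheme.IsRegular U' ∧
            IsEffectiveCartier (I.comap σ))
    (hS : ∀ (U V : Scheme.{0}) (f : U ⟶ Spec (.of k)) (η : V ⟶ U) (I : U.IdealSheafData),
      IsSeparated f → LocallyOfFiniteType f → QuasiCompact f → IsIntegral U → Scheme.IsRegular U →
      I ≠ ⊥ → IsBlowup η I →
        ∃ (Y : Scheme.{0}) (φ : Y ⟶ V), IsResolution φ ∧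
          ∃ W : V.Opens, (W : Set V) = Scheme.regularLocus V ∧ IsIso (φ ∣_ W)) :
    ∀ (U V : Scheme.{0}) (f : U ⟶ Spec (.of k)) (η : V ⟶ U) (I : U.IdealSheafData),
      IsSeparated f → LocallyOfFiniteType f → QuasiCompact f → IsIntegral U → Scheme.IsRegular U →
      I ≠ ⊥ → IsBlowup η I →
        ∃ (J : V.IdealSheafData) (V' : Scheme.{0}) (π : V' ⟶ V),
          J ≠ ⊥ ∧ (∀ x : V, x ∈ J.support → ¬ IsRegularLocalRing (V.presheaf.stalk x)) ∧
            IsBlowup π J ∧ Scheme.IsRegular V' := by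
  intro U V f η I hf₁ hf₂ hf₃ hU hUreg hI hη
  haveI := hf₁; haveI := hf₂; haveI := hf₃; haveI := hU
  haveI : IsLocallyNoetherian U := LocallyOfFiniteType.isLocallyNoetherian f
  haveI : IsIntegral V := hη.isIntegral hI
  haveI : IsProper η := hη.isProper
  let g : V ⟶ Spec (.of k) := η ≫ f
  haveI : IsLocallyNoetherian V := LocallyOfFiniteType.isLocallyNoetherian g
  haveI : CompactSpace V := QuasiCompact.compactSpace_of_compactSpace g
  haveI : IsNoetherian V := {}
  obtain ⟨Y, φ, hres, W, hW, hiso⟩ := hS U V f η I hf₁ hf₂ hf₃ hU hUreg hI hη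
  haveI := hres.isProper
  haveI := hiso
  haveI : IsIntegral Y := by
    haveI := hres.isRegular.isReduced
    exact hres.isBirational.isIntegral
  have hgenW : genericPoint V ∈ W := by
    show genericPoint V ∈ (W : Set V)
    rw [hW]
    apply Scheme.genericPoints_subset_regularLocus
    rw [genericPoints_eq_singleton]
    rfl
  have hA4 : ∀ I' : Y.IdealSheafData, I' ≠ ⊥ →
      ∃ (Q : Y.IdealSheafData) (Y₁ : Scheme.{0}) (σ : Y₁ ⟶ Y),
        (Q.support : Set Y) ⊆ I'.support ∧ IsBlowup σ Q ∧ Scheme.IsRegular Y₁ ∧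
          IsEffectiveCartier (I'.comap σ) := fun I' hI' =>
    hA Y (φ ≫ g) inferInstance inferInstance inferInstance inferInstance hres.isRegular I' hI'
  obtain ⟨Q', V'', ρ, hQ', hQ'T, hρ, hreg''⟩ :=
    exists_isBlowup_supported_isRegular_of_isIso_over φ W hgenW hA4
  refine ⟨Q', V'', ρ, hQ', fun x hx hxreg => ?_, hρ, hreg''⟩
  have : x ∈ (W : Set V) := by rw [hW]; exact hxreg
  exact hQ'T hx this

/-- **The residual of line `birth` at `k`, format-free**: (stub 1 ∧ stub 2) at `k` ⟺ Axiom 4 on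
regular `k`-varieties ∧ strong resolution of their blowings up (any proper birational regular
model isomorphic over the regular locus). The line's open content is therefore Piltant's Axiom 4
plus classical strong resolution of sandwiched singularities over the one perfect field — the
single-blow-up format adds nothing. [cite: Piltant2013, §2 Axiom 4 and Prop. 5.1]
[cite: StacksProject, Tag 081T] -/
theorem patchingPerfect_birthStubsAt_iff_principalization_and_strongRes (k : Type) [Field k] :
    ((∀ (U : Scheme.{0}) (f : U ⟶ Spec (.of k)),
      IsSeparated f → LocallyOfFiniteType f → QuasiCompact f → IsIntegral U → Scheme.IsRegular U →
      ∀ I : U.IdealSheafData, I ≠ ⊥ →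
        ∃ (Q : U.IdealSheafData) (U' : Scheme.{0}) (σ : U' ⟶ U),
          (Q.support : Set U) ⊆ I.support ∧ IsBlowup σ Q ∧ Scheme.IsRegular U' ∧
            IsEffectiveCartier (I.comap σ)) ∧
     ((∀ (U V : Scheme.{0}) (f : U ⟶ Spec (.of k)) (η : V ⟶ U) (I : U.IdealSheafData),
        IsSeparated f → LocallyOfFiniteType f → QuasiCompact f → IsIntegral U →
        Scheme.IsRegular U → I ≠ ⊥ → IsBlowup η I →
          ∃ (J : V.IdealSheafData) (V' : Scheme.{0}) (π : V' ⟶ V),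
            J ≠ ⊥ ∧ (J.support : Set V) ⊆ η ⁻¹' (I.support : Set U) ∧ IsBlowup π J ∧
              Scheme.IsRegular V') →
      (∀ (U V : Scheme.{0}) (f : U ⟶ Spec (.of k)) (η : V ⟶ U) (I : U.IdealSheafData),
        IsSeparated f → LocallyOfFiniteType f → QuasiCompact f → IsIntegral U →
        Scheme.IsRegular U → I ≠ ⊥ → IsBlowup η I →
          ∃ (J : V.IdealSheafData) (V' : Scheme.{0}) (π : V' ⟶ V),
            J ≠ ⊥ ∧ (∀ x : V, x ∈ J.support → ¬ IsRegularLocalRing (V.presheaf.stalk x)) ∧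
              IsBlowup π J ∧ Scheme.IsRegular V'))) ↔
    ((∀ (U : Scheme.{0}) (f : U ⟶ Spec (.of k)),
      IsSeparated f → LocallyOfFiniteType f → QuasiCompact f → IsIntegral U → Scheme.IsRegular U →
      ∀ I : U.IdealSheafData, I ≠ ⊥ →
        ∃ (Q : U.IdealSheafData) (U' : Scheme.{0}) (σ : U' ⟶ U),
          (Q.support : Set U) ⊆ I.support ∧ IsBlowup σ Q ∧ Scheme.IsRegular U' ∧
            IsEffectiveCartier (I.comap σ)) ∧
     (∀ (U V : Scheme.{0}) (f : U ⟶ Spec (.of k)) (η : V ⟶ U) (I : U.IdealSheafData),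
        IsSeparated f → LocallyOfFiniteType f → QuasiCompact f → IsIntegral U →
        Scheme.IsRegular U → I ≠ ⊥ → IsBlowup η I →
          ∃ (Y : Scheme.{0}) (φ : Y ⟶ V), IsResolution φ ∧
            ∃ W : V.Opens, (W : Set V) = Scheme.regularLocus V ∧ IsIso (φ ∣_ W))) := by
  refine ⟨fun h => ⟨h.1, patchingPerfect_birth_strongRes_of_singAdmissible k (h.2 ?_)⟩,
    fun h => ⟨h.1, fun _ =>
      patchingPerfect_birth_singAdmissible_of_principalization_of_strongRes k h.1 h.2⟩⟩
  -- stub 1 at `k` gives exceptional-admissible desingularization at `k` (Stacks 080A backwards)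
  intro U V f η I hf₁ hf₂ hf₃ hU hUreg hI hη
  haveI := hf₁; haveI := hf₂; haveI := hf₃; haveI := hU
  obtain ⟨Q, U', σ, hQI, hσ, hreg, hcart⟩ := h.1 U f hf₁ hf₂ hf₃ hU hUreg I hI
  obtain ⟨V', π, hπ, hreg'⟩ := exists_isBlowup_comap_isRegular hσ hreg hcart hη
  refine ⟨Q.comap η, V', π, ?_, ?_, hπ, hreg'⟩
  · intro h0
    have hsupp : ((Q.comap η).support : Set V) = Set.univ := by
      rw [h0, Scheme.IdealSheafData.support_bot]; rfl
    rw [Scheme.IdealSheafData.support_comap] at hsupp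
    obtain ⟨u, hu⟩ := centreCompl_nonempty (J := I) hI
    let W : U.Opens := ⟨(I.support : Set U)ᶜ, I.support.isClosed.isOpen_compl⟩
    haveI : IsIso (η ∣_ W) := hη.isIso_compl
    obtain ⟨v, hv⟩ := (ConcreteCategory.bijective_of_isIso (η ∣_ W).base).2 ⟨u, hu⟩
    have hηv : η ((η ⁻¹ᵁ W).ι v) = u := by
      have := morphismRestrict_base_coe η W v
      rw [hv] at this
      exact this.symm
    have hmem : (η ⁻¹ᵁ W).ι v ∈ (TopologicalSpace.Closeds.preimage (Q.support) η.continuous :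
        Set V) := by rw [hsupp]; trivial
    rw [TopologicalSpace.Closeds.coe_preimage, Set.mem_preimage, hηv] at hmem
    exact hu (hQI hmem)
  · intro v hv
    rw [Scheme.IdealSheafData.support_comap] at hv
    exact hQI hv

end Summit.ResolutionOfSingularities.ResolutionOfSingularities.Theorems.PatchingPerfect.Negative

end
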